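import Summits.CriticalPhenomena.Ising3DConformalLimit.Theorems.PlantedPinningGaussianPinningSaturationDefs
import Summits.CriticalPhenomena.Ising3DConformalLimit.Theorems.PlantedPinningPinningEfficiencyLeOnePinningLemma
import Summits.CriticalPhenomena.Ising3DConformalLimit.Theorems.PlantedPinningPinningEfficiencyLeOneDLR

/-!
# The variance split `E⁺[Var(M_L | σ_P)] = R_L(P) − N_L(P)` of the planted critical Ising box
(stub A `stub_varianceSplit` of line `birth`, crux `GaussianPinningSaturation`,
item stmt-CriticalPhenomena-8452; objects in `…GaussianPinningSaturationDefs`)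

Informal statement. For the critical `+`-boundary Ising box `Λ_L = box 3 L` on `ℤ³`
(`β = β_c(3)`, `h = 0`), every pin set `P ⊆ Λ_L` and the total spin `M_L = Σ_{x ∈ Λ_L} σ_x`,
the planted conditional variance splits EXACTLY as
`Σ_τ w(τ) · Var^{τ ∨ +}_{Λ_L ∖ P}(M_L) = R_L(P) − N_L(P)` (`stub_varianceSplit`, registered
signature verbatim), where `w = w⁺_{Λ_L}/Z = plusProb L` is the plus-state law of the pattern `τ`,
`R_L(P) = linResidual L P = Var⁺(M_L) − cᵀ (G_{PP})⁻¹ c` is the LINEAR (Schur-complement)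
residual built from the truncated two-point function (`c_a = Cov⁺(M_L, σ_a) = covTot L a`,
`G_{PP} = covMat L P`, `⁻¹` = Mathlib's `Matrix.inv`), and
`N_L(P) = regressionGap L P = Σ_τ w(τ) (E[M_L | σ_P](τ) − Lin_P(τ))²` is the squared norm of the
NONLINEAR part of the planted regression.

Proof. (i) Finite-volume DLR (Friedli–Velenik 2017, Lemma 6.7, eq. (6.5), here
`PlantedPinningCeiling.sum_kernel_isingWeight_eq`): the pinned expectation `⟨·⟩^{τ ∨ +}_{Λ ∖ P}`
is the conditional expectation `E_P` of the finite weighted spin system `(patterns on Λ, w)`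
given the spins on `P`; so the left side is `Σ w M² − Σ w (E_P M)²` (`vbar_eq`), and the plus
expectations entering `cov`, `covTot`, `linPred` are `w`-sums (`isingExpect_eq_sum_div`).
(ii) Law of total variance + normal equations (folklore; `variance_split`, an identity for an
arbitrary class kernel): with `Y = E_P M`, `m = Σ w M`, `q = cᵀ G⁻¹ c` one has
`Cov_w(Y, σ_b) = Cov_w(M, σ_b) = c_b` for `b ∈ P` (self-adjointness of `E_P` against
`P`-measurable test functions, `sum_mul_cexp`), whence
`N = (Σ w Y² − m²) − 2q + uᵀ G u` with `u = c ᵥ* G⁻¹`, and `uᵀ G u = cᵀ G⁻¹ G G⁻¹ c = q` by the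
UNCONDITIONAL identity `A⁻¹ A A⁻¹ = A⁻¹` for Mathlib's inverse of the symmetric matrix `G_{PP}`
(`Matrix.nonsing_inv_mul` / `Matrix.nonsing_inv_apply_not_isUnit`; no positive-definiteness is
used), while `R = (Σ w M² − m²) − q`; hence `R − N = Σ w M² − Σ w Y²`.
Finite sums throughout; no definitions, no named facts.

References: Friedli–Velenik 2017, Lemma 6.7 (finite-volume DLR); law of total variance and the
normal equations of linear least squares (folklore).
-/

noncomputable section

namespace Summit.CriticalPhenomena.Ising3DConformalLimit.PlantedPinningGaussianPinningSaturation

open scoped BigOperators Classical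
open Finset MeasureTheory Matrix
open Literature.Probability.LatticeModels
open Summit.CriticalPhenomena.Ising3DConformalLimit.Theses.PlantedPinning
open Summit.CriticalPhenomena.Ising3DConformalLimit.PlantedPinningCeiling

/-! ### The Pythagoras step of the normal equations: `A⁻¹ A A⁻¹ = A⁻¹` unconditionally -/

section MatrixSandwich

variable {ι : Type*} [Fintype ι] [DecidableEq ι]

/-- For Mathlib's matrix inverse (zero on singular matrices), `A⁻¹ * A * A⁻¹ = A⁻¹` holds
unconditionally. [folklore] -/
private theorem inv_mul_self_mul_inv (A : Matrix ι ι ℝ) : A⁻¹ * A * A⁻¹ = A⁻¹ := by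
  by_cases h : IsUnit A.det
  · rw [Matrix.nonsing_inv_mul A h, one_mul]
  · rw [Matrix.nonsing_inv_apply_not_isUnit A h, mul_zero]

/-- Pythagoras step, matrix form: for symmetric `A`, any `c` and `u = c ᵥ* A⁻¹`,
`u ⬝ (A u) = c ⬝ (A⁻¹ c)`. [folklore] -/
private theorem vecMul_inv_dotProduct_mulVec (A : Matrix ι ι ℝ) (hA : Aᵀ = A) (c : ι → ℝ) :
    (c ᵥ* A⁻¹) ⬝ᵥ (A *ᵥ (c ᵥ* A⁻¹)) = c ⬝ᵥ (A⁻¹ *ᵥ c) := by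
  have ht : A⁻¹ᵀ = A⁻¹ := by rw [Matrix.transpose_nonsing_inv, hA]
  calc (c ᵥ* A⁻¹) ⬝ᵥ (A *ᵥ (c ᵥ* A⁻¹))
      = (c ᵥ* A⁻¹ ᵥ* A) ⬝ᵥ (c ᵥ* A⁻¹) := Matrix.dotProduct_mulVec _ _ _
    _ = (c ᵥ* A⁻¹ ᵥ* A) ⬝ᵥ (A⁻¹ᵀ *ᵥ c) := by rw [Matrix.mulVec_transpose]
    _ = (c ᵥ* A⁻¹ ᵥ* A ᵥ* A⁻¹ᵀ) ⬝ᵥ c := Matrix.dotProduct_mulVec _ _ _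
    _ = (c ᵥ* (A⁻¹ * A * A⁻¹)) ⬝ᵥ c := by
        rw [ht, Matrix.vecMul_vecMul, Matrix.vecMul_vecMul, ← mul_assoc]
    _ = (c ᵥ* A⁻¹) ⬝ᵥ c := by rw [inv_mul_self_mul_inv]
    _ = c ⬝ᵥ (A⁻¹ *ᵥ c) := (Matrix.dotProduct_mulVec _ _ _).symm

/-- Pythagoras step in coordinates: for symmetric `A`, any `c`, and `u_b = Σ_a c_a (A⁻¹)_{ab}`,
`Σ_{b,b'} u_b A_{bb'} u_{b'} = Σ_{a,b} c_a (A⁻¹)_{ab} c_b`. [folklore] -/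
private theorem sandwich_sum (A : Matrix ι ι ℝ) (hA : ∀ i j, A i j = A j i) (c : ι → ℝ) :
    ∑ b, ∑ b', (∑ a, c a * A⁻¹ a b) * A b b' * (∑ a, c a * A⁻¹ a b') =
      ∑ a, ∑ b, c a * A⁻¹ a b * c b := by
  have h := vecMul_inv_dotProduct_mulVec A (Matrix.ext fun i j => hA j i) c
  have hl : (c ᵥ* A⁻¹) ⬝ᵥ (A *ᵥ (c ᵥ* A⁻¹)) =
      ∑ b, ∑ b', (∑ a, c a * A⁻¹ a b) * A b b' * (∑ a, c a * A⁻¹ a b') := by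
    simp only [dotProduct, Matrix.vecMul_apply_eq_sum, Matrix.mulVec_apply_eq_sum]
    refine Finset.sum_congr rfl fun b _ => ?_
    rw [Finset.mul_sum]
    exact Finset.sum_congr rfl fun b' _ => by ring
  have hr : c ⬝ᵥ (A⁻¹ *ᵥ c) = ∑ a, ∑ b, c a * A⁻¹ a b * c b := by
    simp only [dotProduct, Matrix.mulVec_apply_eq_sum]
    refine Finset.sum_congr rfl fun a _ => ?_
    rw [Finset.mul_sum]
    exact Finset.sum_congr rfl fun b _ => by ring
  rw [← hl, ← hr, h]

end MatrixSandwich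

/-! ### Law of total variance + normal equations for a class kernel (abstract finite form) -/

section Abstract

variable {Ω ι : Type*} [Fintype Ω] [Fintype ι]

/-- **Law of total variance + normal equations** along a class kernel `K` (abstract finite
form). Data: positive probability weights `w`, the conditional expectation `E` along `K`
(defining equation `hE`), an observable `M`, `K`-invariant spins `s b` (`b : ι`), any matrix
`Ginv`, and the derived objects entering through their defining equations: means `μ`, `m`,
covariances `c b = Cov_w(M, s b)`, `Gm b b' = Cov_w(s b, s b')`, `u = c ᵥ* Ginv`, the affine
predictor `lin = m + Σ_{a,b} c_a Ginv_{ab} (s_b − μ_b)`, and the Pythagoras hypothesis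
`Σ_{b,b'} u_b Gm_{bb'} u_{b'} = q := Σ_{a,b} c_a Ginv_{ab} c_b`. Then
`Σ w (E M² − (E M)²) = (Σ w M² − m² − q) − Σ w (E M − lin)²`. [folklore] -/
private theorem variance_split (w : Ω → ℝ) (K : Ω → Ω → ℝ) {E : (Ω → ℝ) → Ω → ℝ}
    (hE : ∀ f ω, E f ω = (∑ ω', K ω ω' * w ω' * f ω') / ∑ ω', K ω ω' * w ω')
    (hw : ∀ ω, 0 < w ω) (hw1 : ∑ ω, w ω = 1)
    (h01 : ∀ a b, K a b = 0 ∨ K a b = 1) (hrefl : ∀ a, K a a = 1) (hsymm : ∀ a b, K a b = K b a)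
    (htrans : ∀ a b c, K a b = 1 → K b c = 1 → K a c = 1)
    (M : Ω → ℝ) (s : ι → Ω → ℝ) (hsinv : ∀ b a a', K a a' = 1 → s b a = s b a')
    (Ginv Gm : ι → ι → ℝ) {μ c u : ι → ℝ} {m : ℝ} {lin : Ω → ℝ}
    (hμ : ∀ b, μ b = ∑ ω, w ω * s b ω) (hm : m = ∑ ω, w ω * M ω)
    (hc : ∀ b, c b = ∑ ω, w ω * M ω * s b ω - m * μ b)
    (hG : ∀ b b', Gm b b' = ∑ ω, w ω * s b ω * s b' ω - μ b * μ b')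
    (hu : ∀ b, u b = ∑ a, c a * Ginv a b)
    (hlin : ∀ ω, lin ω = m + ∑ a, ∑ b, c a * Ginv a b * (s b ω - μ b))
    (hq : ∑ b, ∑ b', u b * Gm b b' * u b' = ∑ a, ∑ b, c a * Ginv a b * c b) :
    ∑ ω, w ω * (E (fun ω => M ω ^ 2) ω - (E M ω) ^ 2) =
      (∑ ω, w ω * M ω ^ 2 - m ^ 2 - ∑ a, ∑ b, c a * Ginv a b * c b) -
        ∑ ω, w ω * (E M ω - lin ω) ^ 2 := by
  -- (0) `Σ w (E M) = m` and `Σ w s_b (E M) = Σ w M s_b` (self-adjointness of `E` on `P`-events)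
  have hY1 : ∑ ω, w ω * E M ω = m := by
    rw [hm]; exact sum_w_mul_cexp w K hE hw h01 hrefl hsymm htrans M
  have hY2 : ∀ b, ∑ ω, w ω * s b ω * E M ω = ∑ ω, w ω * M ω * s b ω := fun b => by
    rw [sum_mul_cexp w K hE hw h01 hrefl hsymm htrans (hsinv b) M]
    exact Finset.sum_congr rfl fun ω _ => by ring
  -- (1) the centred affine predictor `lin − m = Σ_b u_b (s_b − μ_b)`
  have hD : ∀ ω, lin ω - m = ∑ b, u b * (s b ω - μ b) := fun ω => by
    rw [hlin, add_sub_cancel_left, Finset.sum_comm]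
    exact Finset.sum_congr rfl fun b _ => by rw [hu, Finset.sum_mul]
  -- (2) `Cov_w(E M, s_b) = c_b` and `Cov_w(s_b, s_b') = Gm b b'`
  have hcY : ∀ b, ∑ ω, w ω * ((E M ω - m) * (s b ω - μ b)) = c b := fun b => by
    have h : ∀ ω, w ω * ((E M ω - m) * (s b ω - μ b)) =
        w ω * s b ω * E M ω - μ b * (w ω * E M ω) - m * (w ω * s b ω) + m * μ b * w ω :=
      fun ω => by ring
    rw [Finset.sum_congr rfl fun ω _ => h ω, Finset.sum_add_distrib, Finset.sum_sub_distrib,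
      Finset.sum_sub_distrib, ← Finset.mul_sum, ← Finset.mul_sum, ← Finset.mul_sum, hY2, hY1,
      ← hμ, hw1, hc]
    ring
  have hGc : ∀ b b', ∑ ω, w ω * ((s b ω - μ b) * (s b' ω - μ b')) = Gm b b' := fun b b' => by
    have h : ∀ ω, w ω * ((s b ω - μ b) * (s b' ω - μ b')) =
        w ω * s b ω * s b' ω - μ b' * (w ω * s b ω) - μ b * (w ω * s b' ω) + μ b * μ b' * w ω :=
      fun ω => by ring
    rw [Finset.sum_congr rfl fun ω _ => h ω, Finset.sum_add_distrib, Finset.sum_sub_distrib,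
      Finset.sum_sub_distrib, ← Finset.mul_sum, ← Finset.mul_sum, ← Finset.mul_sum, ← hμ, ← hμ,
      hw1, hG]
    ring
  -- (3) the three terms of `Σ w ((E M − m) − (lin − m))²`
  have hT1 : ∑ ω, w ω * (E M ω - m) ^ 2 = ∑ ω, w ω * (E M ω) ^ 2 - m ^ 2 := by
    have h : ∀ ω, w ω * (E M ω - m) ^ 2 =
        w ω * (E M ω) ^ 2 - 2 * m * (w ω * E M ω) + m ^ 2 * w ω := fun ω => by ring
    rw [Finset.sum_congr rfl fun ω _ => h ω, Finset.sum_add_distrib, Finset.sum_sub_distrib,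
      ← Finset.mul_sum, ← Finset.mul_sum, hY1, hw1]
    ring
  have hT2 : ∑ ω, w ω * ((E M ω - m) * (lin ω - m)) = ∑ a, ∑ b, c a * Ginv a b * c b := by
    calc ∑ ω, w ω * ((E M ω - m) * (lin ω - m))
        = ∑ ω, ∑ b, u b * (w ω * ((E M ω - m) * (s b ω - μ b))) :=
          Finset.sum_congr rfl fun ω _ => by
            rw [hD, Finset.mul_sum, Finset.mul_sum]
            exact Finset.sum_congr rfl fun b _ => by ring
      _ = ∑ b, u b * c b := by
          rw [Finset.sum_comm]
          exact Finset.sum_congr rfl fun b _ => by rw [← Finset.mul_sum, hcY]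
      _ = ∑ a, ∑ b, c a * Ginv a b * c b := by
          rw [Finset.sum_comm]
          exact Finset.sum_congr rfl fun b _ => by rw [hu, Finset.sum_mul]
  have hT3 : ∑ ω, w ω * (lin ω - m) ^ 2 = ∑ a, ∑ b, c a * Ginv a b * c b := by
    rw [← hq]
    calc ∑ ω, w ω * (lin ω - m) ^ 2
        = ∑ ω, ∑ b, ∑ b', u b * u b' * (w ω * ((s b ω - μ b) * (s b' ω - μ b'))) :=
          Finset.sum_congr rfl fun ω _ => by
            rw [hD, sq, Finset.sum_mul_sum, Finset.mul_sum]
            refine Finset.sum_congr rfl fun b _ => ?_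
            rw [Finset.mul_sum]
            exact Finset.sum_congr rfl fun b' _ => by ring
      _ = ∑ b, ∑ b', u b * Gm b b' * u b' := by
          rw [Finset.sum_comm]
          refine Finset.sum_congr rfl fun b _ => ?_
          rw [Finset.sum_comm]
          exact Finset.sum_congr rfl fun b' _ => by rw [← Finset.mul_sum, hGc]; ring
  -- (4) assemble: `Σ w (E M − lin)² = Σ w (E M)² − m² − q`, then `vbar_eq`
  have hgap : ∑ ω, w ω * (E M ω - lin ω) ^ 2 =
      ∑ ω, w ω * (E M ω) ^ 2 - m ^ 2 - ∑ a, ∑ b, c a * Ginv a b * c b := by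
    have h : ∀ ω, w ω * (E M ω - lin ω) ^ 2 = w ω * (E M ω - m) ^ 2
        - 2 * (w ω * ((E M ω - m) * (lin ω - m))) + w ω * (lin ω - m) ^ 2 := fun ω => by ring
    rw [Finset.sum_congr rfl fun ω _ => h ω, Finset.sum_add_distrib, Finset.sum_sub_distrib,
      ← Finset.mul_sum, hT1, hT2, hT3]
    ring
  rw [vbar_eq w K hE hw h01 hrefl hsymm htrans M, hgap]
  ring

end Abstract

/-! ### The Ising instantiation -/

/-- **Stub A `stub_varianceSplit`** (registered signature, verbatim): for every `L` and every
`P ⊆ Λ_L`, the planted conditional variance of the total spin of the critical `+` box splits as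
linear residual minus nonlinear regression gap,
`Σ_τ (w(τ)/Z) · Var^{τ ∨ +}_{Λ_L ∖ P}(M_L) = R_L(P) − N_L(P)`. Finite-volume DLR
(Friedli–Velenik 2017, Lemma 6.7) + law of total variance / normal equations. [folklore] -/
theorem stub_varianceSplit :
    ∀ (L : ℕ) (P : Finset (Site 3)), P ⊆ box 3 L →
      ∑ τ : ↥(box 3 L) → ℤˣ, plusProb L τ * pinnedVar L P (glue (box 3 L) τ .plus)
        = linResidual L P - regressionGap L P := by
  intro L P hP
  -- the planted law `w = plusProb L` is a probability vector with positive entries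
  have hZpos : 0 < isingPartitionFunction (zdGraph 3) (box 3 L) (criticalBeta 3) 0 .plus :=
    isingPartitionFunction_pos _ _ _ _ _
  have hwpos : ∀ τ, 0 < plusProb L τ := fun τ =>
    div_pos (isingWeight_pos (zdGraph 3) (box 3 L) (criticalBeta 3) 0 .plus τ) hZpos
  have hw1 : ∑ τ, plusProb L τ = 1 := by
    unfold plusProb
    rw [← Finset.sum_div, div_eq_one_iff_eq hZpos.ne']
    rfl
  -- spins of the glued pattern, total spin, agreement kernels, conditional expectation given `P`
  set s : Site 3 → (↥(box 3 L) → ℤˣ) → ℝ := fun x τ => spinAt x (glue (box 3 L) τ .plus)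
  set Mt : (↥(box 3 L) → ℤˣ) → ℝ := fun τ => totalSpin L (glue (box 3 L) τ .plus)
  have hMeq : ∀ τ, Mt τ = ∑ x ∈ box 3 L, s x τ := fun _ => rfl
  set K : Finset (Site 3) → (↥(box 3 L) → ℤˣ) → (↥(box 3 L) → ℤˣ) → ℝ :=
    fun Q a b => if ∀ x ∈ Q, s x a = s x b then 1 else 0 with hK
  have hK1 : ∀ Q a b, (∀ x ∈ Q, s x a = s x b) → K Q a b = 1 := fun Q a b hab => by
    simp only [hK, if_pos hab]
  have hK0 : ∀ Q a b, ¬ (∀ x ∈ Q, s x a = s x b) → K Q a b = 0 := fun Q a b hab => by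
    simp only [hK, if_neg hab]
  obtain ⟨hiff, h01, hrefl, hsymm, htrans⟩ := agreeKernel_props s hK1 hK0 P
  set E : ((↥(box 3 L) → ℤˣ) → ℝ) → (↥(box 3 L) → ℤˣ) → ℝ :=
    fun g τ => (∑ σ, K P τ σ * plusProb L σ * g σ) / ∑ σ, K P τ σ * plusProb L σ
  have hEeq : ∀ g τ, E g τ = (∑ σ, K P τ σ * plusProb L σ * g σ) / ∑ σ, K P τ σ * plusProb L σ :=
    fun _ _ => rfl
  -- (i) finite-volume DLR: pinned expectations are conditional expectations given the spins on `P`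
  have key : ∀ (τ : ↥(box 3 L) → ℤˣ) {f : SpinConfig (Site 3) → ℝ}, Measurable f →
      E (fun σ => f (glue (box 3 L) σ .plus)) τ =
        isingExpect (zdGraph 3) (box 3 L \ P) (criticalBeta 3) 0
          (.fixed (glue (box 3 L) τ .plus)) f := by
    intro τ f hf
    have hdlr := sum_kernel_isingWeight_eq (zdGraph 3) hP (criticalBeta 3) 0 1 (K := K P)
      (hK1 P) (hK0 P) τ hf
    have hKW : 0 < ∑ σ, K P τ σ * isingWeight (zdGraph 3) (box 3 L) (criticalBeta 3) 0 .plus σ :=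
      ksum_one_pos _ (K P) (fun σ => isingWeight_pos _ _ _ _ _ σ) h01 hrefl τ
    have h1 : ∑ σ, K P τ σ * plusProb L σ * f (glue (box 3 L) σ .plus) =
        (∑ σ, K P τ σ * isingWeight (zdGraph 3) (box 3 L) (criticalBeta 3) 0 .plus σ *
          f (glue (box 3 L) σ .plus)) /
          isingPartitionFunction (zdGraph 3) (box 3 L) (criticalBeta 3) 0 .plus := by
      rw [Finset.sum_div]
      exact Finset.sum_congr rfl fun σ _ => by unfold plusProb; ring
    have h2 : ∑ σ, K P τ σ * plusProb L σ =
        (∑ σ, K P τ σ * isingWeight (zdGraph 3) (box 3 L) (criticalBeta 3) 0 .plus σ) /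
          isingPartitionFunction (zdGraph 3) (box 3 L) (criticalBeta 3) 0 .plus := by
      rw [Finset.sum_div]
      exact Finset.sum_congr rfl fun σ _ => by unfold plusProb; ring
    rw [hEeq, h1, h2, div_div_div_cancel_right₀ hZpos.ne', div_eq_iff hKW.ne', mul_comm]
    exact hdlr
  have hmM : Measurable (totalSpin L) := by
    show Measurable fun σ : SpinConfig (Site 3) => ∑ x ∈ box 3 L, spinAt x σ
    exact Finset.measurable_sum _ fun x _ => measurable_spinAt x
  have hmean : ∀ τ, pinnedMean L P (glue (box 3 L) τ .plus) = E Mt τ := fun τ => by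
    unfold pinnedMean
    exact (key τ hmM).symm
  have hpv : ∀ τ, pinnedVar L P (glue (box 3 L) τ .plus) =
      E (fun σ => Mt σ ^ 2) τ - (E Mt τ) ^ 2 := fun τ => by
    have e1 : isingExpect (zdGraph 3) (box 3 L \ P) (criticalBeta 3) 0
        (.fixed (glue (box 3 L) τ .plus)) (totalSpin L) = E Mt τ := (key τ hmM).symm
    have e2 : isingExpect (zdGraph 3) (box 3 L \ P) (criticalBeta 3) 0
        (.fixed (glue (box 3 L) τ .plus)) (fun σ => totalSpin L σ ^ 2) =
          E (fun σ => Mt σ ^ 2) τ := (key τ (hmM.pow_const 2)).symm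
    unfold pinnedVar
    rw [e1, e2]
  -- (ii) plus expectations as `w`-sums: means, covariances, total covariances, variance of `M`
  have hplusE : ∀ {f : SpinConfig (Site 3) → ℝ}, Measurable f →
      plusE L f = ∑ τ, plusProb L τ * f (glue (box 3 L) τ .plus) := by
    intro f hf
    unfold plusE plusProb
    rw [isingExpect_eq_sum_div (zdGraph 3) (box 3 L) 0 .plus (criticalBeta 3) hf, Finset.sum_div]
    exact Finset.sum_congr rfl fun τ _ => by ring
  have hμ : ∀ x, plusE L (spinAt x) = ∑ τ, plusProb L τ * s x τ := fun x =>
    hplusE (measurable_spinAt x)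
  have hm : plusE L (totalSpin L) = ∑ τ, plusProb L τ * Mt τ := hplusE hmM
  have hcov : ∀ x y, cov L x y =
      ∑ τ, plusProb L τ * s x τ * s y τ - plusE L (spinAt x) * plusE L (spinAt y) := by
    intro x y
    unfold cov
    have h : ∀ τ,
        plusProb L τ * (spinAt x (glue (box 3 L) τ .plus) * spinAt y (glue (box 3 L) τ .plus)) =
          plusProb L τ * s x τ * s y τ := fun τ => (mul_assoc _ _ _).symm
    rw [hplusE ((measurable_spinAt x).fun_mul (measurable_spinAt y)),
      Finset.sum_congr rfl fun τ _ => h τ]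
  have hsumμ : ∑ x ∈ box 3 L, plusE L (spinAt x) = plusE L (totalSpin L) := by
    rw [hm, Finset.sum_congr rfl fun x _ => hμ x, Finset.sum_comm]
    exact Finset.sum_congr rfl fun τ _ => by rw [hMeq, Finset.mul_sum]
  have hcovTot : ∀ a, covTot L a =
      ∑ τ, plusProb L τ * Mt τ * s a τ - plusE L (totalSpin L) * plusE L (spinAt a) := by
    intro a
    unfold covTot
    have h : ∀ τ, ∑ x ∈ box 3 L, plusProb L τ * s x τ * s a τ = plusProb L τ * Mt τ * s a τ :=
      fun τ => by rw [hMeq, Finset.mul_sum, Finset.sum_mul]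
    rw [Finset.sum_congr rfl fun x _ => hcov x a, Finset.sum_sub_distrib, ← Finset.sum_mul,
      hsumμ, Finset.sum_comm, Finset.sum_congr rfl fun τ _ => h τ]
  have hvar : ∑ x ∈ box 3 L, ∑ y ∈ box 3 L, cov L x y =
      ∑ τ, plusProb L τ * Mt τ ^ 2 - plusE L (totalSpin L) ^ 2 := by
    rw [Finset.sum_comm]
    show ∑ y ∈ box 3 L, covTot L y = _
    have h : ∀ τ, ∑ y ∈ box 3 L, plusProb L τ * Mt τ * s y τ = plusProb L τ * Mt τ ^ 2 :=
      fun τ => by rw [← Finset.mul_sum, ← hMeq]; ring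
    rw [Finset.sum_congr rfl fun y _ => hcovTot y, Finset.sum_sub_distrib, ← Finset.mul_sum,
      hsumμ, Finset.sum_comm, Finset.sum_congr rfl fun τ _ => h τ, sq]
  -- symmetry of the covariance matrix of the pinned spins
  have hsym : ∀ i j : ↥P, covMat L P i j = covMat L P j i := by
    intro i j
    show cov L i.1 j.1 = cov L j.1 i.1
    have h : ∀ τ, plusProb L τ * s i.1 τ * s j.1 τ = plusProb L τ * s j.1 τ * s i.1 τ :=
      fun τ => by ring
    rw [hcov, hcov, Finset.sum_congr rfl fun τ _ => h τ]
    ring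
  -- (iii) rewrite the three route objects and apply the abstract split
  have hL : ∑ τ, plusProb L τ * pinnedVar L P (glue (box 3 L) τ .plus) =
      ∑ τ, plusProb L τ * (E (fun σ => Mt σ ^ 2) τ - (E Mt τ) ^ 2) :=
    Finset.sum_congr rfl fun τ _ => by rw [hpv τ]
  have hR : regressionGap L P =
      ∑ τ, plusProb L τ * (E Mt τ - linPred L P (glue (box 3 L) τ .plus)) ^ 2 := by
    unfold regressionGap
    exact Finset.sum_congr rfl fun τ _ => by rw [hmean τ]
  have hRes : linResidual L P = ∑ τ, plusProb L τ * Mt τ ^ 2 - plusE L (totalSpin L) ^ 2 -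
      ∑ a : ↥P, ∑ b : ↥P, covTot L a.1 * (covMat L P)⁻¹ a b * covTot L b.1 := by
    unfold linResidual
    rw [hvar]
  -- the data of the abstract split, indexed by the pinned sites `↥P`
  have hsP : ∀ (b : ↥P) (a a' : ↥(box 3 L) → ℤˣ), K P a a' = 1 → s b.1 a = s b.1 a' :=
    fun b a a' hab => (hiff a a').1 hab b.1 b.2
  have hμP : ∀ b : ↥P, plusE L (spinAt b.1) = ∑ τ, plusProb L τ * s b.1 τ := fun b => hμ b.1
  have hcP : ∀ b : ↥P, covTot L b.1 =
      ∑ τ, plusProb L τ * Mt τ * s b.1 τ - plusE L (totalSpin L) * plusE L (spinAt b.1) :=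
    fun b => hcovTot b.1
  have hGP : ∀ b b' : ↥P, covMat L P b b' =
      ∑ τ, plusProb L τ * s b.1 τ * s b'.1 τ - plusE L (spinAt b.1) * plusE L (spinAt b'.1) :=
    fun b b' => by unfold covMat; rw [Matrix.of_apply]; exact hcov b.1 b'.1
  have hlinP : ∀ τ, linPred L P (glue (box 3 L) τ .plus) = plusE L (totalSpin L) +
      ∑ a, ∑ b, covTot L a.1 * (covMat L P)⁻¹ a b * (s b.1 τ - plusE L (spinAt b.1)) :=
    fun τ => by unfold linPred; rfl
  have hfin := variance_split (plusProb L) (K P) hEeq hwpos hw1 h01 hrefl hsymm htrans Mt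
    (fun (b : ↥P) (τ : ↥(box 3 L) → ℤˣ) => s b.1 τ) hsP (fun a b : ↥P => (covMat L P)⁻¹ a b)
    (fun a b : ↥P => covMat L P a b)
    (μ := fun b : ↥P => plusE L (spinAt b.1)) (c := fun a : ↥P => covTot L a.1)
    (u := fun b : ↥P => ∑ a, covTot L a.1 * (covMat L P)⁻¹ a b) (m := plusE L (totalSpin L))
    (lin := fun τ : ↥(box 3 L) → ℤˣ => linPred L P (glue (box 3 L) τ .plus))
    hμP hm hcP hGP (fun _ => rfl) hlinP (sandwich_sum (covMat L P) hsym fun a : ↥P => covTot L a.1)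
  rw [hL, hR, hRes]
  exact hfin

end Summit.CriticalPhenomena.Ising3DConformalLimit.PlantedPinningGaussianPinningSaturation

end
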